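import Mathlib
import Summits.ResolutionOfSingularities.ResolutionOfSingularities.Theorems.SyzygyFlatteningDefs
import Summits.ResolutionOfSingularities.ResolutionOfSingularities.Theorems.SyzygyFlatteningHigherRankTerminationTowerStageBasic
import Summits.ResolutionOfSingularities.ResolutionOfSingularities.Theorems.SyzygyFlatteningHigherRankTerminationLocAt
import Summits.ResolutionOfSingularities.ResolutionOfSingularities.Theorems.SyzygyFlatteningHigherRankTerminationSingIdealLocAt
import Summits.ResolutionOfSingularities.ResolutionOfSingularities.Theorems.SyzygyFlatteningHigherRankTerminationEssFiniteType
import Summits.ResolutionOfSingularities.ResolutionOfSingularities.Theorems.SyzygyFlatteningHigherRankTerminationTowerLocalisation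
import Literature.AlgebraicGeometry.Resolution.RankOneReductionProofs
import HarnessLib

/-!
# `stub_stageNormal` — stages of the syzygy-flattening tower from `T₁` on are normal

Crux `SyzygyFlattening.RankOneTermination` (stmt-ResolutionOfSingularities-17044), line `birth`,
registered stub `stub_stageNormal`: for a valuation ring `O ⊇ k` of `K`, an affine model
`A ⊆ O` with `Frac A = K`, and every `m`, the stage
`tower O A (m + 1) = locAt O (nrm (chart O (tower O A m)))` (`Theorems/SyzygyFlatteningDefs.lean`)
is an integrally closed domain.

Proof.
* `isIntegrallyClosed_nrm` — for a `k`-subalgebra `C` of `K` with `Frac C = K`, the normalisation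
  `nrm C` (whose carrier is the set of elements of `K` integral over `C`, `mem_nrm_iff`) is
  integrally closed: `Frac (nrm C) = K`, and an element of `K` integral over `nrm C` is integral
  over `C` by transitivity of integrality (`isIntegral_trans`), hence lies in `nrm C`.
* `comap_isUnitSubmonoid_le_nonZeroDivisors` — the submonoid of `B` at which `locAt O B` is the
  localisation of `B` (`isLocalization_locAt`: the elements of `B` that become units in
  `locAt O B`) consists of non-zero-divisors (a unit of a nontrivial ring is non-zero).
* `isIntegrallyClosed_locAt` — hence `locAt O B` is integrally closed when `B ⊆ O` is
  (Mathlib's `isIntegrallyClosed_of_isLocalization`: a localisation of an integrally closed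
  domain at non-zero-divisors is integrally closed).
* `stub_stageNormal` — `C := chart O (tower O A m)` contains `A`, so `Frac C = K`
  (`isFractionRing_subalgebra_of_le`), `nrm C ⊆ O` (`nrm_toSubring_le`, `chart_toSubring_le`,
  `tower_toSubring_le`), and `tower O A (m + 1) = locAt O (nrm C)`.

References: Atiyah–Macdonald 1969, Cor. 5.5 (the integral closure is integrally closed) and
Prop. 5.12 (integral closure commutes with localisation). The hypothesis `A.FG` of the registered
signature is not used.
-/

noncomputable section

-- single-problem summit: the doubled namespace component `ResolutionOfSingularities` is forced
set_option linter.dupNamespace false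

namespace Summit.ResolutionOfSingularities.ResolutionOfSingularities.Theorems.SyzygyFlattening

open Literature.AlgebraicGeometry.Resolution

open scoped nonZeroDivisors

variable {k K : Type} [Field k] [Field K] [Algebra k K]

/-! ## The normalisation inside `K` is integrally closed -/

/-- `nrm C` is an integral extension of `C` (through the inclusion `C ≤ nrm C`): every element
of `nrm C` is integral over `C` (`mem_nrm_iff`). [folklore] -/
theorem isIntegral_nrm (C : Subalgebra k K) :
    @Algebra.IsIntegral ↥C ↥(nrm C) _ _
      (Subalgebra.inclusion (self_le_nrm C)).toRingHom.toAlgebra := by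
  letI : Algebra ↥C ↥(nrm C) := (Subalgebra.inclusion (self_le_nrm C)).toRingHom.toAlgebra
  haveI : IsScalarTower ↥C ↥(nrm C) K := IsScalarTower.of_algebraMap_eq fun _ => rfl
  refine ⟨fun y => ?_⟩
  have hy : IsIntegral ↥C (algebraMap ↥(nrm C) K y) := (mem_nrm_iff C).mp y.2
  exact (isIntegral_algebraMap_iff (R := ↥C) (A := ↥(nrm C)) (B := K)
    Subtype.val_injective).mp hy

/-- **The normalisation `nrm C` of a `k`-subalgebra `C` of `K = Frac C` is integrally closed**:
`Frac (nrm C) = K`, and an element of `K` integral over `nrm C` is integral over `C`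
(transitivity of integrality along the integral extension `C ≤ nrm C`), so it lies in `nrm C`.
[cite: AtiyahMacdonald1969, Cor. 5.5] -/
theorem isIntegrallyClosed_nrm (C : Subalgebra k K) [IsFractionRing ↥C K] :
    IsIntegrallyClosed ↥(nrm C) := by
  haveI : IsFractionRing ↥(nrm C) K := isFractionRing_subalgebra_of_le C (nrm C) (self_le_nrm C)
  refine (isIntegrallyClosed_iff K).mpr fun {x} hx => ?_
  letI : Algebra ↥C ↥(nrm C) := (Subalgebra.inclusion (self_le_nrm C)).toRingHom.toAlgebra
  haveI : IsScalarTower ↥C ↥(nrm C) K := IsScalarTower.of_algebraMap_eq fun _ => rfl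
  haveI : Algebra.IsIntegral ↥C ↥(nrm C) := isIntegral_nrm C
  exact ⟨⟨x, (mem_nrm_iff C).mpr (isIntegral_trans (R := ↥C) x hx)⟩, rfl⟩

/-! ## Localisation at the centre preserves normality -/

/-- The submonoid of `B` at which `locAt O B` is the localisation of `B` — the elements of `B`
that become units in `locAt O B` — consists of non-zero-divisors: a unit of the nontrivial ring
`locAt O B ⊆ K` is non-zero. [folklore] -/
theorem comap_isUnitSubmonoid_le_nonZeroDivisors (O : ValuationSubring K) (B : Subalgebra k K) :
    (IsUnit.submonoid ↥(locAt O B)).comap (Subalgebra.inclusion (self_le_locAt O B)) ≤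
      (↥B)⁰ := by
  intro s hs
  refine mem_nonZeroDivisors_of_ne_zero ?_
  rintro rfl
  have h : IsUnit (Subalgebra.inclusion (self_le_locAt O B) (0 : ↥B)) := hs
  rw [map_zero] at h
  exact not_isUnit_zero h

/-- **Localisation at the centre of `O` preserves normality**: for an integrally closed
`k`-subalgebra `B ⊆ O` of `K`, `locAt O B` is integrally closed — it is the localisation of the
integrally closed domain `B` at a submonoid of non-zero-divisors (`isLocalization_locAt`,
`comap_isUnitSubmonoid_le_nonZeroDivisors`), and integral closure commutes with localisation
(Mathlib's `isIntegrallyClosed_of_isLocalization`). [cite: AtiyahMacdonald1969, Prop. 5.12] -/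
theorem isIntegrallyClosed_locAt (O : ValuationSubring K) (B : Subalgebra k K)
    (h : B.toSubring ≤ O.toSubring) [IsIntegrallyClosed ↥B] :
    IsIntegrallyClosed ↥(locAt O B) := by
  letI : Algebra ↥B ↥(locAt O B) :=
    (Subalgebra.inclusion (self_le_locAt O B)).toRingHom.toAlgebra
  haveI := isLocalization_locAt O B h
  exact isIntegrallyClosed_of_isLocalization ↥(locAt O B)
    ((IsUnit.submonoid ↥(locAt O B)).comap (Subalgebra.inclusion (self_le_locAt O B)))
    (comap_isUnitSubmonoid_le_nonZeroDivisors O B)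

/-! ## The registered stub -/

/-- **STUB `stub_stageNormal`** (crux stmt-ResolutionOfSingularities-17044, line `birth`).
Every stage of the syzygy-flattening tower from `T₁` on is an integrally closed domain:
`tower O A (m + 1) = locAt O (nrm C)` with `C := chart O (tower O A m)` a `k`-subalgebra of
`K` containing `A`, so `Frac C = K`; `nrm C` is integrally closed (the integral closure of `C` in
`K`, closed by transitivity of integrality) with `nrm C ⊆ O`, and `locAt O (nrm C)` is a
localisation of the normal domain `nrm C` at non-zero-divisors, hence normal. (`A.FG` is not
used.) [cite: AtiyahMacdonald1969, Prop. 5.12] -/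
theorem stub_stageNormal : ∀ (k K : Type) [Field k] [Field K] [Algebra k K]
    (O : ValuationSubring K) (A : Subalgebra k K), (∀ c : k, algebraMap k K c ∈ O) → A.FG →
      IsFractionRing ↥A K → A.toSubring ≤ O.toSubring →
      ∀ m : ℕ, IsIntegrallyClosed ↥(tower O A (m + 1)) := by
  intro k K _ _ _ O A hk _hFG hFrac hAO m
  -- the chart `C` of stage `m`: `A ≤ tower O A m ≤ C ⊆ O`
  have hT : (tower O A m).toSubring ≤ O.toSubring := tower_toSubring_le O hk hAO m
  have hC : (chart O (tower O A m)).toSubring ≤ O.toSubring := chart_toSubring_le O hk hT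
  have hN : (nrm (chart O (tower O A m))).toSubring ≤ O.toSubring := nrm_toSubring_le O hk hC
  haveI : IsFractionRing ↥(chart O (tower O A m)) K :=
    haveI := isFractionRing_tower O A hFrac m
    isFractionRing_subalgebra_of_le (tower O A m) (chart O (tower O A m))
      (self_le_chart O (tower O A m))
  haveI : IsIntegrallyClosed ↥(nrm (chart O (tower O A m))) :=
    isIntegrallyClosed_nrm (chart O (tower O A m))
  rw [tower_succ]
  exact isIntegrallyClosed_locAt O (nrm (chart O (tower O A m))) hN

end Summit.ResolutionOfSingularities.ResolutionOfSingularities.Theorems.SyzygyFlattening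

end
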